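import Summits.BirchSwinnertonDyer.BirchSwinnertonDyer.Theorems.ManinLocalTwoThreeVeluFiveKummer
import Summits.BirchSwinnertonDyer.BirchSwinnertonDyer.Theorems.ManinLocalTwoThreeSplitFiveCyclotomicSieve
import Summits.BirchSwinnertonDyer.BirchSwinnertonDyer.Theorems.ManinLocalTwoThreeSplitFiveFamilyReduction
import Summits.BirchSwinnertonDyer.Rank1Residual.ManinAdditive.ShimuraFiveRootNumber
import HarnessLib

/-!
# Manin `c = ±1`, local two/three programme — **E-es-228 `ShimuraFiveSquarefreeOnlyAtEleven` is a
# theorem** (T-es-98; road ε closed unconditionally)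

Cell `bsd-f2-manin`, es lens (gen 44), `--supports stmt-BirchSwinnertonDyer-22967` (crux C2
`ManinOddAtFour`).  MEMO-es §68, CANDIDATES R-es-172.

THEOREM (`shimuraFiveSquarefreeOnlyAtEleven_holds`).  Let `W₀/ℚ` be globally minimal elliptic,
`D₀` a lattice-optimal `X₀(N)`-datum (`Λ(L₀) = c₀Λ₀(f)`), `N` squarefree and
`5 ∣ [Λ₀(f) : Λ₁(f)]`.  Then `N = 11`.

PROOF (all steps tree theorems; NO named fact is used — at squarefree level `N = N_{W₀}` is the
tree's `IsNewformOf.level_eq_conductorNorm_of_squarefree_level`, and `λ_p(f) = w_p(W₀)` at `p ∥ N`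
is the tree's `atkinLehnerEigenvalueAt_eq_localRootNumberAt_of_not_sq_dvd`).
1. (cusp lifting + cover kernel, es g41–g43) `W₀(ℚ)` has a point of order `5` and `W₀[5]` is fixed
   by `Gal(ℚ̄/ℚ(μ₅))`; (E-es-239, T-es-95) hence `C • W₀ = veluFive (s⁵)` for some `s = U/V ∈ ℚ×`,
   `gcd(U,V) = 1`, and (T-es-97 §2) `K′(U⁵,V⁵) ⊗ ℚ ≅ W₀` with
   `Δ(K′) = U⁵V⁵(U¹⁰ − 11U⁵V⁵ − V¹⁰)⁵`, `U¹⁰ − 11U⁵V⁵ − V¹⁰ = (U² − UV − V²)·Q₈(U,V)`.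
2. (§1 here) a prime `p ∥ N` at which `W₀` is SPLIT multiplicative is `11`: `λ_p = w_p = −1`
   (Rohrlich) while the Ling–Oesterlé/Atkin–Lehner profile of a `5` in the Shimura index
   (`ShimuraSieve.level_profile_five_of_squarefree'`) gives `a_p = −1`, `λ_p = −a_p = +1` at every
   `p ∣ N` other than `11`.
3. (T-es-97 F1) every prime of `UV` is split multiplicative for `K′`, hence for `W₀`: so it is `11`.
   (T-es-97 F2 + T-es-96 A1) a prime `q ≠ 5` of `Q₈(U,V)` is multiplicative for `W₀`, so `q ∣ N`,
   so `q = 11` or `q ≡ 4 (mod 5)` — and the cyclotomic sieve A1 excludes the latter.  (T-es-96 A2)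
   therefore `UV = ±1`, and `Δ(K′) = −11⁵`.
4. (T-es-97 F4) every prime of `N` is bad for `W₀`, hence for `K′`, hence divides `11⁵`; with
   `11 ∣ N` (ROAD β, `ShimuraFive.eleven_dvd_level_of_not_shimuraIndexPrimeTo_five_of_squarefree`)
   and `N` squarefree, `N = 11`.

COROLLARY (not restated here; node-file one-liner).  E-es-224 `ShimuraFiveOnlyAtEleven` (any
level) follows from the two NAMED FACTS Carayol (`N = N_{W₀}`, `hC`) and Kellock–Dokchitser/Deligne
(`λ_p = w_p`, `hF1`, used only at the additive prime `5`):
`EsG43.shimuraFiveOnlyAtEleven_of_splitFiveTorsionRootNumberLaw splitFiveTorsionRootNumberLaw_holds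
hC hF1 shimuraFiveSquarefreeOnlyAtEleven_holds`.

ON PRINT.  Byeon–Kim (Acta Arith. 165 (2014), Thm. 1.1) state the squarefree case for the
`E₀/E₁`-kernel under the provisos `5 ∤ N`, `C(ℚ)[5] ≠ 0`; their §3 treats `uv = ±1, ±p` and leaves
the sub-case `uv = ±p^{5j}` to the reader — closed here by the cyclotomic sieve (T-es-96).  So this
file is printed mathematics with a completed proof, newly formalised; it is NOT a beyond-print
theorem about BSD: C2/C3 of the route stay OPEN ⟸ CDT, Manin's conjecture and BSD are not proved.
References: [ByeonKim2014, Thm. 1.1, Prop. 4.1, §3]; [LingOesterle1991, Thm. 6];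
[AtkinLehner1970, Thm. 3]; [Rohrlich1993Compositio, Prop. 2]; [KellockDokchitser2023, Rem. 2.2];
[Carayol1986]; [Velu1971]; [SilvermanAEC2009, VII.5 Prop. 5.1].
-/

set_option linter.dupNamespace false
set_option autoImplicit false

noncomputable section

open scoped Classical MatrixGroups ModularForm PeriodPair

open CongruenceSubgroup WeierstrassCurve Field IsDedekindDomain IsDedekindDomain.HeightOneSpectrum
  Rat.HeightOneSpectrum Literature.NumberTheory.EllipticCurves
  Literature.NumberTheory.EllipticCurves.ModularForms Literature.NumberTheory.EllipticCurves.KubertTateVelu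
  Summit.BirchSwinnertonDyer.Rank1Residual Summit.BirchSwinnertonDyer.Rank1Residual.ManinAdditive
  Summit.BirchSwinnertonDyer.Rank1Residual.ManinAdditive.KatoCurve
  Summit.BirchSwinnertonDyer.Rank1Residual.ManinAdditive.EsG43

namespace Summit.BirchSwinnertonDyer.BirchSwinnertonDyer.Theorems.ManinLocalTwoThree.ShimuraFive

/-! ### §1. A split multiplicative prime of a `5`-Shimura datum at squarefree level is `11` -/

/-- **A split multiplicative prime is `11`.**  For a globally minimal elliptic `W₀/ℚ` with an
`X₀(N)`-datum `D₀`, `N` squarefree and `5 ∣ [Λ₀(f) : Λ₁(f)]`: if `W₀` is split multiplicative at the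
place of a prime `p`, then `p = 11`.  Indeed `N = N_{W₀}` (squarefree level), `p ∥ N`,
`λ_p(f) = w_p(W₀) = −1` (Rohrlich), whereas every `p ∣ N`, `p ≠ 11` has `a_p(f) = −1`, i.e.
`λ_p = −a_p = +1` (Ling–Oesterlé sign law). [cite: LingOesterle1991, Thm. 6]
[cite: AtkinLehner1970, Thm. 3] [cite: Rohrlich1993Compositio, Prop. 2(ii)]
[cite: KellockDokchitser2023, Rem. 2.2] -/
theorem eq_eleven_of_hasSplitMultiplicativeReductionAt (W₀ : WeierstrassCurve ℚ) [W₀.IsElliptic]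
    [W₀.IsGloballyMinimal] {N : ℕ} [NeZero N] (D₀ : ModularParametrizationData W₀ N)
    (hsq : Squarefree N) (hS : ¬ ShimuraIndexPrimeTo 5 D₀.f) {p : ℕ} (hp : p.Prime)
    (hsplit : W₀.HasSplitMultiplicativeReductionAt ((primesEquiv (R := ℤ)).symm ⟨p, hp⟩)) :
    p = 11 := by
  have hN : W₀.conductorNorm ℤ = N :=
    ShimuraPrimeLevelAtTwo.conductorNorm_eq_of_squarefree_level D₀ hsq
  subst hN
  set P : Nat.Primes := ⟨p, hp⟩ with hP
  have hgen : natGenerator ((primesEquiv (R := ℤ)).symm P) = p :=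
    congrArg (fun q : Nat.Primes ↦ (q : ℕ)) ((primesEquiv (R := ℤ)).apply_symm_apply P)
  have hpN : p ∣ W₀.conductorNorm ℤ := by
    rw [← hgen]
    exact (natGenerator_dvd_conductorNorm_iff _ W₀).mpr
      hsplit.hasMultiplicativeReductionAt.not_hasGoodReductionAt
  have hp2 : ¬ p ^ 2 ∣ W₀.conductorNorm ℤ := fun h ↦ hp.not_isUnit (hsq p (by simpa [sq] using h))
  rcases (ShimuraSieve.level_profile_five_of_squarefree' W₀ D₀ hsq hS hp hpN).2.2.2 with h | ⟨-, hap⟩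
  · exact h
  · exfalso
    have h1 : atkinLehnerEigenvalueAt D₀.f p = 1 := by
      rw [ShimuraSieve.atkinLehnerEigenvalueAt_eq_neg_cuspCoeff D₀.isNewformOf.1 hp hpN hp2, hap,
        neg_neg]
    have h2 : atkinLehnerEigenvalueAt D₀.f (P : ℕ) =
        (W₀.localRootNumberAt ((primesEquiv (R := ℤ)).symm P) : ℂ) :=
      W₀.atkinLehnerEigenvalueAt_eq_localRootNumberAt_of_not_sq_dvd D₀.isNewformOf P hpN hp2
    rw [localRootNumberAt_of_hasSplitMultiplicativeReductionAt hsplit] at h2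
    have h12 : (1 : ℂ) = ((-1 : ℤ) : ℂ) := h1.symm.trans h2
    norm_num at h12

/-! ### §2. The Diophantine step: `C • W₀ = veluFive ((U/V)⁵)` forces `N = 11` -/

/-- A prime of `Q₈(U,V)` does not divide `UV` (`gcd(U,V) = 1`; `Q₈ ≡ V⁸ (mod U)`, `≡ U⁸ (mod V)`).
[cite: ByeonKim2014, §3] -/
theorem not_dvd_mul_of_dvd_splitFiveOctic {U V : ℤ} (hUV : IsCoprime U V) {p : ℤ} (hp : Prime p)
    (h : p ∣ splitFiveOctic U V) : ¬ p ∣ U * V := by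
  have hunit : ¬ (p ∣ U ∧ p ∣ V) := fun ⟨hU, hV⟩ ↦ hp.not_unit (hUV.isUnit_of_dvd' hU hV)
  intro hUV'
  rcases hp.dvd_or_dvd hUV' with hU | hV
  · refine hunit ⟨hU, hp.dvd_of_dvd_pow (n := 8) ?_⟩
    rw [splitFiveOctic_eq_pow_add_mul U V] at h
    exact (dvd_add_left (hU.mul_right _)).mp h
  · refine hunit ⟨hp.dvd_of_dvd_pow (n := 8) ?_, hV⟩
    have e := splitFiveOctic_eq_pow_add_mul V (-U)
    rw [splitFiveOctic_swap_neg, Even.neg_pow (by decide : Even 8)] at e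
    rw [e] at h
    exact (dvd_add_left (hV.mul_right _)).mp h

/-- **The Diophantine step of E-es-228.**  For a globally minimal elliptic `W₀/ℚ` with an
`X₀(N)`-datum, `N` squarefree, `5 ∣ [Λ₀(f) : Λ₁(f)]`, and `C • W₀ = veluFive ((U/V)⁵)` with
`gcd(U,V) = 1`, `UV ≠ 0`: `N = 11`.  (F1: primes of `UV` are split, hence `11`; F2 + A1: primes
`≠ 5` of `Q₈(U,V)` divide `N`, hence are `11`; A2: `UV = ±1`, `Δ(K′(U⁵,V⁵)) = −11⁵`; F4: every
prime of `N` divides `11⁵`; `11 ∣ N` squarefree.) [cite: ByeonKim2014, Thm. 1.1 and §3]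
[cite: SilvermanAEC2009, VII.5 Prop. 5.1] [cite: LingOesterle1991, Thm. 6] -/
theorem level_eq_eleven_of_smul_eq_veluFive (W₀ : WeierstrassCurve ℚ) [W₀.IsElliptic]
    [W₀.IsGloballyMinimal] {N : ℕ} [NeZero N] (D₀ : ModularParametrizationData W₀ N)
    (hsq : Squarefree N) (hS : ¬ ShimuraIndexPrimeTo 5 D₀.f) {U V : ℤ} (hUV : IsCoprime U V)
    (hU0 : U ≠ 0) (hV0 : V ≠ 0) (C : VariableChange ℚ)
    (hCW : C • W₀ = veluFive (((U : ℚ) / V) ^ 5)) : N = 11 := by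
  -- the integer model `K′(U⁵,V⁵)` is `ℚ`-isomorphic to `W₀`
  obtain ⟨D, hE⟩ : ∃ D : VariableChange ℚ,
      (kubertTateFive' (U ^ 5) (V ^ 5)).baseChange ℚ = D • (C • W₀) :=
    ⟨_, by rw [hCW]; exact baseChange_kubertTateFive'_pow_five_eq_smul_veluFive U V hV0⟩
  haveI hEll : ((kubertTateFive' (U ^ 5) (V ^ 5)).baseChange ℚ).IsElliptic := by
    rw [hE]; infer_instance
  have hmn : IsCoprime (U ^ 5) (V ^ 5) := hUV.pow
  -- transport of the reduction types along `hE`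
  have tsplit : ∀ v : HeightOneSpectrum ℤ,
      ((kubertTateFive' (U ^ 5) (V ^ 5)).baseChange ℚ).HasSplitMultiplicativeReductionAt v →
        W₀.HasSplitMultiplicativeReductionAt v := fun v h ↦ by
    rw [hE] at h
    exact (hasSplitMultiplicativeReductionAt_smul_iff_holds v W₀ C).mp
      ((hasSplitMultiplicativeReductionAt_smul_iff_holds v (C • W₀) D).mp h)
  have tmult : ∀ v : HeightOneSpectrum ℤ,
      ((kubertTateFive' (U ^ 5) (V ^ 5)).baseChange ℚ).HasMultiplicativeReductionAt v →
        W₀.HasMultiplicativeReductionAt v := fun v h ↦ by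
    rw [hE] at h
    exact (hasMultiplicativeReductionAt_smul_iff_holds v W₀ C).mp
      ((hasMultiplicativeReductionAt_smul_iff_holds v (C • W₀) D).mp h)
  have tgood : ∀ v : HeightOneSpectrum ℤ,
      ((kubertTateFive' (U ^ 5) (V ^ 5)).baseChange ℚ).HasGoodReductionAt v →
        W₀.HasGoodReductionAt v := fun v h ↦ by
    rw [hE] at h
    exact (hasGoodReductionAt_smul_iff_holds v W₀ C).mp
      ((hasGoodReductionAt_smul_iff_holds v (C • W₀) D).mp h)
  -- at squarefree level the level is the conductor
  have hN : W₀.conductorNorm ℤ = N :=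
    ShimuraPrimeLevelAtTwo.conductorNorm_eq_of_squarefree_level D₀ hsq
  have hgen : ∀ P : Nat.Primes, natGenerator ((primesEquiv (R := ℤ)).symm P) = P := fun P ↦
    congrArg (fun q : Nat.Primes ↦ (q : ℕ)) ((primesEquiv (R := ℤ)).apply_symm_apply P)
  -- (i) every prime of `UV` is split multiplicative, hence `11`
  have hp11 : ∀ p : ℕ, p.Prime → (p : ℤ) ∣ U * V → p = 11 := by
    intro p hp hpUV
    refine eq_eleven_of_hasSplitMultiplicativeReductionAt W₀ D₀ hsq hS hp (tsplit _ ?_)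
    refine hasSplitMultiplicativeReductionAt_kubertTateFive'_of_dvd _ hmn ?_
    rw [hgen, ← mul_pow]
    exact hpUV.trans (dvd_pow_self _ (by norm_num))
  -- (ii) the primes of `Q₈(U,V)` are `5` or `11`
  have hQ : (11 : ℤ) ∣ U * V → ∀ p : ℕ, p.Prime → (p : ℤ) ∣ splitFiveOctic U V →
      p = 5 ∨ p = 11 := by
    intro _ p hp hpQ
    by_cases hp5 : p = 5
    · exact Or.inl hp5
    refine Or.inr ?_
    have hpZ : Prime (p : ℤ) := Nat.prime_iff_prime_int.mp hp
    have hndUV : ¬ (p : ℤ) ∣ U * V := not_dvd_mul_of_dvd_splitFiveOctic hUV hpZ hpQ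
    have hg : ((natGenerator ((primesEquiv (R := ℤ)).symm ⟨p, hp⟩) : ℕ) : ℤ) ∣
        (U ^ 5) ^ 2 - 11 * U ^ 5 * V ^ 5 - (V ^ 5) ^ 2 := by
      rw [hgen]
      have e : (U ^ 5) ^ 2 - 11 * U ^ 5 * V ^ 5 - (V ^ 5) ^ 2 =
          (U ^ 2 - U * V - V ^ 2) * splitFiveOctic U V := by
        rw [← splitFiveNorm_eq_mul_splitFiveOctic]; ring
      rw [e]
      exact hpQ.mul_left _
    have h5 : ¬ ((natGenerator ((primesEquiv (R := ℤ)).symm ⟨p, hp⟩) : ℕ) : ℤ) ∣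
        3125 * (U ^ 5) ^ 2 * (V ^ 5) ^ 2 := by
      rw [hgen]
      intro h
      have e : (3125 : ℤ) * (U ^ 5) ^ 2 * (V ^ 5) ^ 2 = 5 ^ 5 * (U * V) ^ 10 := by ring
      rw [e] at h
      rcases hpZ.dvd_or_dvd h with h' | h'
      · have h55 : (p : ℤ) ∣ (5 : ℕ) := by exact_mod_cast hpZ.dvd_of_dvd_pow h'
        exact hp5 ((Nat.prime_dvd_prime_iff_eq hp (by norm_num)).mp (Int.natCast_dvd_natCast.mp h55))
      · exact hndUV (hpZ.dvd_of_dvd_pow h')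
    have hmultW : W₀.HasMultiplicativeReductionAt ((primesEquiv (R := ℤ)).symm ⟨p, hp⟩) :=
      tmult _ (hasMultiplicativeReductionAt_kubertTateFive'_of_dvd_norm _ hg h5)
    have hpN : p ∣ N := by
      have h := (natGenerator_dvd_conductorNorm_iff _ W₀).mpr hmultW.not_hasGoodReductionAt
      rw [hgen, hN] at h
      exact h
    rcases (ShimuraSieve.level_profile_five_of_squarefree' W₀ D₀ hsq hS hp hpN).2.2.2 with h | ⟨hmod, -⟩
    · exact h
    · exact absurd hpQ (not_prime_dvd_splitFiveOctic hUV hp (by omega) hp5 (by omega))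
  -- (iii) hence `UV = ±1` and `Δ(K′(U⁵,V⁵)) = −11⁵`
  have hUV1 := mul_eq_one_or_eq_neg_one_of_splitFive_primes hUV hU0 hV0 hp11 hQ
  have hΔ : U ^ 5 * V ^ 5 * ((U ^ 5) ^ 2 - 11 * U ^ 5 * V ^ 5 - (V ^ 5) ^ 2) ^ 5 = -(11 ^ 5) := by
    rcases hUV1 with h | h
    · rcases Int.eq_one_or_neg_one_of_mul_eq_one' h with ⟨hU, hV⟩ | ⟨hU, hV⟩ <;>
        (rw [hU, hV]; norm_num)
    · rcases Int.eq_one_or_neg_one_of_mul_eq_neg_one' h with ⟨hU, hV⟩ | ⟨hU, hV⟩ <;>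
        (rw [hU, hV]; norm_num)
  -- (iv) every prime of `N` is `11`
  have hall : ∀ p : ℕ, p.Prime → p ∣ N → p = 11 := by
    intro p hp hpN
    have hbadW : ¬ W₀.HasGoodReductionAt ((primesEquiv (R := ℤ)).symm ⟨p, hp⟩) := by
      rw [← natGenerator_dvd_conductorNorm_iff _ W₀, hgen, hN]
      exact hpN
    have hdvd : ((natGenerator ((primesEquiv (R := ℤ)).symm ⟨p, hp⟩) : ℕ) : ℤ) ∣
        U ^ 5 * V ^ 5 * ((U ^ 5) ^ 2 - 11 * U ^ 5 * V ^ 5 - (V ^ 5) ^ 2) ^ 5 := by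
      by_contra h
      exact hbadW (tgood _ (hasGoodReductionAt_kubertTateFive' _ h))
    rw [hgen, hΔ, dvd_neg] at hdvd
    have h' : p ∣ 11 ^ 5 := by exact_mod_cast hdvd
    exact (Nat.prime_dvd_prime_iff_eq hp (by norm_num)).mp (hp.dvd_of_dvd_pow h')
  -- (v) `11 ∣ N` (ROAD β), `N` squarefree, all primes `11` ⟹ `N = 11`
  obtain ⟨k, hk⟩ := eleven_dvd_level_of_not_shimuraIndexPrimeTo_five_of_squarefree W₀ hsq D₀ hS
  by_cases hk1 : k = 1
  · rw [hk, hk1]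
  · exfalso
    obtain ⟨q, hq, hqk⟩ := Nat.exists_prime_and_dvd hk1
    have hqN : q ∣ N := by rw [hk]; exact hqk.mul_left 11
    obtain rfl := hall q hq hqN
    have h121 : 11 * 11 ∣ N := by rw [hk]; exact mul_dvd_mul_left 11 hqk
    exact absurd (Nat.isUnit_iff.mp (hsq 11 h121)) (by norm_num)

/-! ### §3. E-es-228 is a theorem -/

/-- **E-es-228 `ShimuraFiveSquarefreeOnlyAtEleven` HOLDS** (unconditionally): at squarefree level a
`5` in the Shimura-cover kernel `[Λ₀(f) : Λ₁(f)]` of a lattice-optimal `X₀(N)`-datum of a minimal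
`W₀/ℚ` occurs only at `N = 11`.  Byeon–Kim's Theorem 1.1 for the `Λ₀/Λ₁` kernel, with the
sub-case `uv = ±p^{5j}` of their §3 closed by the cyclotomic sieve.
[cite: ByeonKim2014, Thm. 1.1 and §3] [cite: LingOesterle1991, Thm. 6] [cite: Velu1971]
[cite: SilvermanAEC2009, VII.5 Prop. 5.1] [cite: Rohrlich1993Compositio, Prop. 2(ii)] -/
theorem shimuraFiveSquarefreeOnlyAtEleven_holds : ShimuraFiveSquarefreeOnlyAtEleven := by
  intro W₀ _ _ N _ D₀ hopt hsq hS
  obtain ⟨s, C, hCW⟩ := splitFiveTorsionModuli_holds W₀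
    (CuspLifting.exists_addOrderOf_eq_prime D₀ hopt (by norm_num) hS)
    (smul_eq_self_of_not_shimuraIndexPrimeTo_five W₀ D₀ hopt hS)
  haveI hVe : (veluFive (s ^ 5)).IsElliptic := by rw [← hCW]; infer_instance
  -- `s ≠ 0`: `veluFive 0` is singular (tree `not_isElliptic_veluFive_zero`)
  have hs0 : s ≠ 0 := by
    rintro rfl
    exact not_isElliptic_veluFive_zero hVe
  refine level_eq_eleven_of_smul_eq_veluFive W₀ D₀ hsq hS (U := s.num) (V := (s.den : ℤ))
    (Int.isCoprime_iff_gcd_eq_one.mpr s.reduced) (Rat.num_ne_zero.mpr hs0)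
    (by exact_mod_cast s.den_pos.ne') C ?_
  rw [hCW, Int.cast_natCast, Rat.num_div_den]

end Summit.BirchSwinnertonDyer.BirchSwinnertonDyer.Theorems.ManinLocalTwoThree.ShimuraFive

end
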